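import Literature.MathematicalPhysics.QuantumLattice.HeisenbergOrderNeelInfrared
import Literature.MathematicalPhysics.QuantumLattice.HeisenbergGroundStateSymmetry
import Literature.MathematicalPhysics.QuantumLattice.HeisenbergModelGlobalRotationProofs
import Literature.MathematicalPhysics.QuantumLattice.FinDimSpectrumGibbsLimitProofs
import Literature.MathematicalPhysics.QuantumLattice.FinDimSpectrumSpectralGapProofs
import Literature.MathematicalPhysics.QuantumLattice.AndersonHeisenbergStarBound
import Literature.Probability.LatticeModels.TorusBipartite
import HarnessLib

/-!
# The Horsch–von der Linden bound for the Heisenberg antiferromagnet with the sharp model constant: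
# `(E₁ - E₀) · ω₀(𝓢_π) ≤ 4 |E₀|`

For the spin-`n/2` Heisenberg antiferromagnet `H = Σ_{⟨x,y⟩} 𝐒_x·𝐒_y` (`J = 1`) on the even torus
`(ℤ/Lℤ)^d` (`d ≥ 1`, `2 ∣ L`) and the staggered structure operator
`𝓢_π = Σ_{x,y} (-1)^x (-1)^y 𝐒_x·𝐒_y` we prove the finite-volume inequality

  `Δ · Re ω₀(𝓢_π) ≤ -4 E₀(H)`                                    (`gap_mul_re_stagStructure_le`)

for every `Δ` such that the spectrum of `H` lies in `{E₀} ∪ [E₀ + Δ, ∞)` (in particular for the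
spectral gap, `HasSpectralGap H Δ`, i.e. `Δ ≤ E₁ - E₀`), together with the energy-free corollary
for spin `½` (`L ≥ 3`): `Δ · Re ω₀(𝓢_π) ≤ (d + 1) L^d` (Anderson's bound `E₀ ≥ -(d+1) L^d / 4`),
i.e. `(E₁ - E₀) · m_s(L)² ≤ (d + 1) / L^d` for the Néel order parameter `m_s² = ω₀(𝓢_π) / L^{2d}`.
This is the Horsch–von der Linden "low-lying states" estimate (Horsch–von der Linden 1988;
Koma–Tasaki 1993 §7, eq. (7.9); Koma–Tasaki 1994 Thm. 2.2; Tasaki 2019 §2) for this model with the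
constant made sharp and explicit: the variational state `A₀ Φ₀`, `A₀ = Σ_x (-1)^x Sˣ_x`, has
`ω₀(A₀ (H - E₀) A₀) = ½ ω₀([A₀, [H, A₀]]) = -(4/3) E₀` *exactly* (every bond contributes
`-8 ω₀(Sˣ_x Sˣ_y)` to the double commutator, and `E₀ = 3 Σ_bonds ω₀(Sˣ_x Sˣ_y)` by isotropy), it is
orthogonal to the ground space (`Sᶻ_tot` annihilates the ground space, Lieb–Mattis, and
`A₀ = -i [Σ_x (-1)^x Sʸ_x, Sᶻ_tot]`), and `ω₀(A₀²) = ω₀(𝓢_π) / 3` by `SU(2)` invariance.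

The abstract variational step is the tracial-state lemma `gap_mul_re_groundStateFunctional_le`:
if the spectrum of a Hermitian `A` lies in `{E₀} ∪ [E₀ + Δ, ∞)` and `P₀ W P₀ = 0`, then
`Δ · ω₀(W⋆ W) ≤ ω₀(W⋆ (A - E₀) W)` (from `A - E₀ - Δ (1 - P₀) ⪰ 0`).

Consequences: any certified lower bound `ω₀(𝓢_π) ≥ L^{2d} μ` (Kennedy–Lieb–Shastry / Marshall
floors) and upper bound `E₀ ≥ -ε` certify the spin-gap ceiling `E₁ - E₀ ≤ 4 ε / (L^{2d} μ)`; and in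
the thermodynamic limit (`not_hasStaggeredEvenTorusLRO_of_uniform_gap`, spin ½): a spectral gap
`≥ Δ > 0` above a unique ground state on all large even tori excludes staggered long-range order
(`HasStaggeredEvenTorusLRO`), since then `m_s(L)² ≤ (d+1) / (Δ L^d) → 0` — Néel order forces
low-lying states.
-/

noncomputable section

open Matrix Finset Filter Topology
open scoped ComplexOrder
open Literature.MathematicalPhysics.QuantumLattice
  Literature.MathematicalPhysics.QuantumLattice.SpinOperators Literature.Probability.LatticeModels

namespace Matrix

variable {m : Type*} [Fintype m] [DecidableEq m]

/-- **The gap form is positive**: if every eigenvalue of the Hermitian `A` is either `E₀` or at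
least `E₀ + Δ`, then `A - E₀ - Δ (1 - P₀) ⪰ 0`, `P₀` the ground-state projection (diagonal in the
eigenbasis with entries `0` resp. `λⱼ - E₀ - Δ ≥ 0`). Tasaki (2020) §2.1, App. A.2.
[cite: Tasaki2020, §2.1] [folklore] -/
theorem IsHermitian.posSemidef_sub_groundEnergy_sub_gap {A : Matrix m m ℂ} (hA : A.IsHermitian)
    {Δ : ℝ}
    (hgap : ∀ j, hA.eigenvalues j = A.groundEnergy ∨ A.groundEnergy + Δ ≤ hA.eigenvalues j) :
    (A - (A.groundEnergy : ℂ) • 1 - (Δ : ℂ) • (1 - A.groundProj)).PosSemidef := by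
  -- the eigenvalues of the gap form in the eigenbasis of `A`
  let μ : m → ℝ := fun j =>
    if hA.eigenvalues j = A.groundEnergy then 0 else hA.eigenvalues j - A.groundEnergy - Δ
  have hμ0 : ∀ j, 0 ≤ μ j := by
    intro j
    by_cases hj : hA.eigenvalues j = A.groundEnergy
    · simp [μ, hj]
    · have h := (hgap j).resolve_left hj
      simp only [μ, if_neg hj]
      linarith
  have key : ∀ j, (A - (A.groundEnergy : ℂ) • 1 - (Δ : ℂ) • (1 - A.groundProj)) *ᵥ
      ⇑(hA.eigenvectorBasis j) = ((μ j : ℝ) : ℂ) • ⇑(hA.eigenvectorBasis j) := by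
    intro j
    have hAj : A *ᵥ ⇑(hA.eigenvectorBasis j) =
        ((hA.eigenvalues j : ℝ) : ℂ) • ⇑(hA.eigenvectorBasis j) := by
      rw [hA.mulVec_eigenvectorBasis j, RCLike.real_smul_eq_coe_smul (K := ℂ)]
      rfl
    simp only [sub_mulVec, smul_mulVec, one_mulVec, hAj]
    by_cases hj : hA.eigenvalues j = A.groundEnergy
    · rw [hA.groundProj_mulVec_eigenvectorBasis_of_eq hj, sub_self, smul_zero, sub_zero, hj,
        sub_self]
      simp [μ, hj]
    · rw [hA.groundProj_mulVec_eigenvectorBasis_of_ne hj, sub_zero, ← sub_smul, ← sub_smul]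
      congr 1
      simp only [μ, if_neg hj]
      push_cast
      ring
  have hMU : (A - (A.groundEnergy : ℂ) • 1 - (Δ : ℂ) • (1 - A.groundProj)) *
      (hA.eigenvectorUnitary : Matrix m m ℂ) =
        (hA.eigenvectorUnitary : Matrix m m ℂ) * diagonal (fun j => ((μ j : ℝ) : ℂ)) := by
    ext i j
    have h1 : ((A - (A.groundEnergy : ℂ) • 1 - (Δ : ℂ) • (1 - A.groundProj)) *
        (hA.eigenvectorUnitary : Matrix m m ℂ)) i j =
          ((A - (A.groundEnergy : ℂ) • 1 - (Δ : ℂ) • (1 - A.groundProj)) *ᵥ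
            ⇑(hA.eigenvectorBasis j)) i := by
      simp only [mul_apply, mulVec, dotProduct, IsHermitian.eigenvectorUnitary_apply]
    rw [h1, key j, mul_diagonal, Pi.smul_apply, smul_eq_mul, mul_comm,
      IsHermitian.eigenvectorUnitary_apply]
  have hUU : (hA.eigenvectorUnitary : Matrix m m ℂ) * star (hA.eigenvectorUnitary : Matrix m m ℂ)
      = 1 := Unitary.mul_star_self_of_mem hA.eigenvectorUnitary.prop
  have hMeq : A - (A.groundEnergy : ℂ) • 1 - (Δ : ℂ) • (1 - A.groundProj) =
      (hA.eigenvectorUnitary : Matrix m m ℂ) * diagonal (fun j => ((μ j : ℝ) : ℂ)) *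
        (hA.eigenvectorUnitary : Matrix m m ℂ)ᴴ := by
    rw [← hMU, Matrix.mul_assoc, ← star_eq_conjTranspose, hUU, Matrix.mul_one]
  have hD : (diagonal fun j => ((μ j : ℝ) : ℂ)).PosSemidef :=
    posSemidef_diagonal_iff.2 fun j => Complex.zero_le_real.2 (hμ0 j)
  rw [hMeq]
  exact hD.mul_mul_conjTranspose_same _

/-- **The Horsch–von der Linden variational step, tracial form.** If the spectrum of the Hermitian
`A` lies in `{E₀} ∪ [E₀ + Δ, ∞)` and the trial operator `W` satisfies `P₀ W P₀ = 0` (the trial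
state `W Φ₀` is orthogonal to the ground space), then `Δ · ω₀(W⋆ W) ≤ ω₀(W⋆ (A - E₀) W)`:
`0 ≤ ω₀(W⋆ (A - E₀ - Δ(1 - P₀)) W)` and `ω₀(W⋆ P₀ W) = tr (P₀ W⋆ (P₀ W P₀)) / tr P₀ = 0`.
Koma–Tasaki (1993) §7, eqs. (7.5)–(7.9); Tasaki (2019) §2. [cite: KomaTasaki1993, §7 (7.5)–(7.9)]
[cite: Tasaki2019Tower, §2] -/
theorem IsHermitian.gap_mul_re_groundStateFunctional_le {A : Matrix m m ℂ} (hA : A.IsHermitian)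
    {Δ : ℝ}
    (hgap : ∀ j, hA.eigenvalues j = A.groundEnergy ∨ A.groundEnergy + Δ ≤ hA.eigenvalues j)
    {W : Matrix m m ℂ} (hW : A.groundProj * W * A.groundProj = 0) :
    Δ * (A.groundStateFunctional (Wᴴ * W)).re ≤
      (A.groundStateFunctional (Wᴴ * (A - (A.groundEnergy : ℂ) • 1) * W)).re := by
  have hM := hA.posSemidef_sub_groundEnergy_sub_gap hgap
  have h0 : 0 ≤ A.groundStateFunctional
      (Wᴴ * (A - (A.groundEnergy : ℂ) • 1 - (Δ : ℂ) • (1 - A.groundProj)) * W) :=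
    groundStateFunctional_nonneg_of_posSemidef A (hM.conjTranspose_mul_mul_same W)
  -- the `P₀` term vanishes
  have hP : A.groundStateFunctional (Wᴴ * A.groundProj * W) = 0 := by
    rw [groundStateFunctional_apply]
    have htr : (A.groundProj * (Wᴴ * A.groundProj * W)).trace = 0 := by
      calc (A.groundProj * (Wᴴ * A.groundProj * W)).trace
          = (A.groundProj * A.groundProj * (Wᴴ * A.groundProj * W)).trace := by
            rw [groundProj_mul_self]
        _ = (A.groundProj * (Wᴴ * A.groundProj * W) * A.groundProj).trace := by
            rw [Matrix.mul_assoc, trace_mul_comm]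
        _ = (A.groundProj * Wᴴ * (A.groundProj * W * A.groundProj)).trace := by
            simp only [Matrix.mul_assoc]
        _ = 0 := by rw [hW, Matrix.mul_zero, trace_zero]
    rw [htr, mul_zero]
  have hexp : Wᴴ * (A - (A.groundEnergy : ℂ) • 1 - (Δ : ℂ) • (1 - A.groundProj)) * W =
      Wᴴ * (A - (A.groundEnergy : ℂ) • 1) * W - (Δ : ℂ) • (Wᴴ * W) +
        (Δ : ℂ) • (Wᴴ * A.groundProj * W) := by
    simp only [Matrix.mul_sub, Matrix.sub_mul, Matrix.mul_smul, Matrix.smul_mul, Matrix.mul_one,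
      smul_sub]
    abel
  rw [hexp, map_add, map_sub, map_smul, map_smul, hP, smul_zero, add_zero, smul_eq_mul] at h0
  obtain ⟨hre, -⟩ := Complex.nonneg_iff.1 h0
  rw [Complex.sub_re, Complex.re_ofReal_mul] at hre
  linarith

/-- Under a spectral gap `Δ` above a unique ground state every eigenvalue is `E₀` or `≥ E₀ + Δ`
(unfolding of `HasSpectralGap`, `hasSpectralGap_iff_card_filter`). Tasaki (2020) §2.1.
[cite: Tasaki2020, §2.1] [folklore] -/
theorem HasSpectralGap.eigenvalues_eq_or_le {A : Matrix m m ℂ} {Δ : ℝ} (h : A.HasSpectralGap Δ)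
    (hA : A.IsHermitian) (j : m) :
    hA.eigenvalues j = A.groundEnergy ∨ A.groundEnergy + Δ ≤ hA.eigenvalues j := by
  obtain ⟨-, -, hsub⟩ := (hA.hasSpectralGap_iff_card_filter Δ).1 h
  simpa [Set.mem_union, Set.mem_Ici] using hsub ⟨j, rfl⟩

end Matrix

namespace Literature.MathematicalPhysics.QuantumLattice

variable {d : ℕ}

section NeelWave

variable (L : ℕ) [NeZero L] (n : ℕ)

/-- The Néel sign flips along every bond of the even torus. [cite: DysonLiebSimon1978, §2]
[folklore] -/
private theorem neelSign_of_adj (hL : 2 ∣ L) {x y : TorusSite d L}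
    (h : (torusGraph d L).Adj x y) : neelSign y = -neelSign x := by
  have hcast : ∀ z : TorusSite d L,
      torusSiteParity hL z = ((∑ j, (z j).val : ℕ) : ZMod 2) := by
    intro z
    unfold torusSiteParity
    rw [Nat.cast_sum]
    refine sum_congr rfl fun j _ => ?_
    rw [ZMod.castHom_apply, ZMod.cast_eq_val]
  have hpar := torusSiteParity_of_adj hL h
  rw [hcast, hcast, ← Nat.cast_one, ← Nat.cast_add, ZMod.natCast_eq_natCast_iff'] at hpar
  simp only [neelSign]
  rcases Nat.even_or_odd (∑ j, (x j).val) with hx | hx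
  · have hy : Odd (∑ j, (y j).val) := by
      rw [Nat.odd_iff]; rw [Nat.even_iff] at hx; omega
    rw [hx.neg_one_pow, hy.neg_one_pow]
  · have hy : Even (∑ j, (y j).val) := by
      rw [Nat.even_iff]; rw [Nat.odd_iff] at hx; omega
    rw [hx.neg_one_pow, hy.neg_one_pow, neg_neg]

/-- `Sˣ_x = -i [Sʸ_x, Sᶻ_tot]` (`[Sʸ, Sᶻ] = i Sˣ` on site, distinct sites commute).
Tasaki (2020) §2.2, (2.2.11). [cite: Tasaki2020, §2.2] [folklore] -/
private theorem siteSpin_zero_eq_commutator {Λ : Type*} [Fintype Λ] [DecidableEq Λ] (u : Λ) :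
    (siteSpin n u 0 : Op Λ (n + 1)) =
      -Complex.I • (siteSpin n u 1 * totalSpin n 2 - totalSpin n 2 * siteSpin n u 1) := by
  rw [siteSpin_mul_totalSpin_sub, spinVec_one, spinVec_two, lie_spinY_spinZ, onSite_smul',
    smul_smul, show -Complex.I * Complex.I = 1 by rw [neg_mul, Complex.I_mul_I, neg_neg],
    one_smul]
  rfl

/-- **`Sᶻ_tot` annihilates the ground space** of the Heisenberg antiferromagnet on the even torus
(`d ≥ 1`): `Sᶻ_tot P₀ = 0`, since the ground space lies in the `Sᶻ_tot = 0` sector (Lieb–Mattis: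
the even torus is connected and bipartite with equal parts). [cite: LiebMattis1962, Theorem 2] -/
theorem totalSpin_mul_groundProj_heisenbergTorus (hd : 1 ≤ d) (hL : 2 ∣ L) :
    (totalSpin n 2 : Op (TorusSite d L) (n + 1)) * (heisenbergTorus d L n 1).groundProj = 0 := by
  have hle := LiebMattis.groundSpace_le_spinZSector_zero n (torusGraph d L)
    (evenSublattice (d := d) L hL) 1 (torusGraph_connected_of_proj d L)
    (torusGraph_isBipartiteWith_evenSublattice (d := d) L hL) one_pos
    (card_compl_evenSublattice (d := d) L hL ⟨0, hd⟩)
  apply Matrix.toLin'.injective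
  refine LinearMap.ext fun v => ?_
  rw [Matrix.toLin'_mul, LinearMap.comp_apply, Matrix.toLin'_apply, Matrix.toLin'_apply, map_zero,
    LinearMap.zero_apply]
  have hmem := hle (Matrix.groundProj_mulVec_mem (heisenbergTorus d L n 1) v)
  simp only [spinZSector, Module.End.mem_eigenspace_iff, Matrix.toLin'_apply, Complex.ofReal_zero,
    zero_smul] at hmem
  exact hmem

/-- **The Néel-wave trial state is orthogonal to the ground space**: `P₀ A₀ P₀ = 0` for
`A₀ = Σ_x (-1)^x Sˣ_x`, because `A₀ = -i [Σ_x (-1)^x Sʸ_x, Sᶻ_tot]` and `Sᶻ_tot P₀ = P₀ Sᶻ_tot = 0`.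
Horsch–von der Linden (1988); Koma–Tasaki (1993) §7. [cite: HorschVonDerLinden1988]
[cite: KomaTasaki1993, §7] -/
theorem groundProj_mul_neelWave_mul_groundProj (hd : 1 ≤ d) (hL : 2 ∣ L) :
    (heisenbergTorus d L n 1).groundProj *
        (∑ u : TorusSite d L, ((neelSign u : ℝ) : ℂ) • (siteSpin n u 0 : Op (TorusSite d L) (n + 1))) *
      (heisenbergTorus d L n 1).groundProj = 0 := by
  have h1 := totalSpin_mul_groundProj_heisenbergTorus L n hd hL
  have h2 : (heisenbergTorus d L n 1).groundProj * (totalSpin n 2 : Op (TorusSite d L) (n + 1)) = 0 := by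
    have h := congrArg conjTranspose h1
    rwa [conjTranspose_mul, (groundProj_isHermitian _).eq, (totalSpin_isHermitian n 2).eq,
      conjTranspose_zero] at h
  have hsite : ∀ u : TorusSite d L, (heisenbergTorus d L n 1).groundProj *
      (siteSpin n u 0 : Op (TorusSite d L) (n + 1)) * (heisenbergTorus d L n 1).groundProj = 0 := by
    intro u
    rw [siteSpin_zero_eq_commutator n u, Matrix.mul_smul, Matrix.smul_mul, Matrix.mul_sub,
      Matrix.sub_mul]
    have e1 : (heisenbergTorus d L n 1).groundProj * (siteSpin n u 1 * totalSpin n 2) *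
        (heisenbergTorus d L n 1).groundProj = (heisenbergTorus d L n 1).groundProj *
          siteSpin n u 1 * (totalSpin n 2 * (heisenbergTorus d L n 1).groundProj) := by
      simp only [Matrix.mul_assoc]
    have e2 : (heisenbergTorus d L n 1).groundProj * (totalSpin n 2 * siteSpin n u 1) *
        (heisenbergTorus d L n 1).groundProj = (heisenbergTorus d L n 1).groundProj *
          totalSpin n 2 * (siteSpin n u 1 * (heisenbergTorus d L n 1).groundProj) := by
      simp only [Matrix.mul_assoc]
    rw [e1, e2, h1, h2, Matrix.mul_zero, Matrix.zero_mul, sub_self, smul_zero]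
  rw [Finset.mul_sum, Finset.sum_mul]
  refine Finset.sum_eq_zero fun u _ => ?_
  rw [Matrix.mul_smul, Matrix.smul_mul, hsite u, smul_zero]

/-- **The double commutator of the Néel wave, exactly**: for `A₀ = Σ_x (-1)^x Sˣ_x`,
`Re ω₀([A₀, [H, A₀]]) = -8 Σ_bonds ω₀(Sˣ_x Sˣ_y) = -(8/3) E₀` (bondwise `(a_x - a_y)² = 4` on the
even torus; `E₀ = 3 Σ_bonds ω₀(Sˣ_x Sˣ_y)` by isotropy). Koma–Tasaki (1993) §7, eq. (7.9);
Kennedy–Lieb–Shastry (1988) eq. (13). [cite: KomaTasaki1993, §7 (7.9)] [cite: KLS1988JSP, eq. (13)] -/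
theorem re_groundStateFunctional_lie_lie_neelWave (hL : 2 ∣ L) :
    ((heisenbergTorus d L n 1).groundStateFunctional
      ⁅(∑ u : TorusSite d L, ((neelSign u : ℝ) : ℂ) • (siteSpin n u 0 : Op (TorusSite d L) (n + 1))),
        ⁅heisenbergTorus d L n 1,
          ∑ u : TorusSite d L, ((neelSign u : ℝ) : ℂ) •
            (siteSpin n u 0 : Op (TorusSite d L) (n + 1))⁆⁆).re =
      -(8 / 3) * (heisenbergTorus d L n 1).groundEnergy := by
  rw [re_groundStateFunctional_heis_lie_lie L n (neelSign (d := d) (L := L)),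
    groundEnergy_heisenbergTorus_eq, ← mul_assoc, show (-(8 / 3 : ℝ)) * 3 = -8 by norm_num,
    Finset.mul_sum]
  refine sum_congr rfl fun e he => ?_
  revert he
  refine Sym2.ind (fun x y hxy => ?_) e
  have hadj : (torusGraph d L).Adj x y := by
    rwa [SimpleGraph.mem_edgeFinset, SimpleGraph.mem_edgeSet] at hxy
  simp only [Sym2.lift_mk]
  rw [neelSign_of_adj L hL hadj]
  have hsq : neelSign x ^ 2 = 1 := by
    rw [neelSign, ← pow_mul, mul_comm, pow_mul, neg_one_sq, one_pow]
  rw [show (neelSign x - -neelSign x) ^ 2 = 4 * neelSign x ^ 2 by ring, hsq]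
  ring

/-- **`SU(2)` invariance**: `Re ω₀(𝓢_π) = 3 Re ω₀(A₀²)` for the staggered structure operator
`𝓢_π = Σ_{x,y} (-1)^x (-1)^y 𝐒_x·𝐒_y` and the Néel wave `A₀ = Σ_x (-1)^x Sˣ_x`
(`ω₀(S¹_x S¹_y) = ω₀(S²_x S²_y) = ω₀(S⁰_x S⁰_y)`). Kennedy–Lieb–Shastry (1988) p. 1021.
[cite: KLS1988JSP, p. 1021] -/
theorem re_groundStateFunctional_stagStructure_eq :
    ((heisenbergTorus d L n 1).groundStateFunctional
        (∑ x : TorusSite d L, ∑ y : TorusSite d L, ((neelSign x * neelSign y : ℝ) : ℂ) •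
          ∑ α : Fin 3, (siteSpin n x α * siteSpin n y α : Op (TorusSite d L) (n + 1)))).re =
      3 * ((heisenbergTorus d L n 1).groundStateFunctional
        ((∑ x : TorusSite d L, ((neelSign x : ℝ) : ℂ) •
            (siteSpin n x 0 : Op (TorusSite d L) (n + 1))) *
          ∑ y : TorusSite d L, ((neelSign y : ℝ) : ℂ) •
            (siteSpin n y 0 : Op (TorusSite d L) (n + 1)))).re := by
  have hR : ((heisenbergTorus d L n 1).groundStateFunctional
      ((∑ x : TorusSite d L, ((neelSign x : ℝ) : ℂ) •
          (siteSpin n x 0 : Op (TorusSite d L) (n + 1))) *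
        ∑ y : TorusSite d L, ((neelSign y : ℝ) : ℂ) •
          (siteSpin n y 0 : Op (TorusSite d L) (n + 1)))).re =
      ∑ x : TorusSite d L, ∑ y : TorusSite d L,
        neelSign x * neelSign y * heisGroundCorr 0 L n x y := by
    rw [groundStateFunctional_realWave_mul, Complex.re_sum]
    refine sum_congr rfl fun x _ => ?_
    rw [Complex.re_sum]
    refine sum_congr rfl fun y _ => ?_
    rw [Complex.re_ofReal_mul, ← heisGroundCorr_of_neZero]
  have hL' : ((heisenbergTorus d L n 1).groundStateFunctional
      (∑ x : TorusSite d L, ∑ y : TorusSite d L, ((neelSign x * neelSign y : ℝ) : ℂ) •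
        ∑ α : Fin 3, (siteSpin n x α * siteSpin n y α : Op (TorusSite d L) (n + 1)))).re =
      ∑ x : TorusSite d L, ∑ y : TorusSite d L,
        neelSign x * neelSign y * (3 * heisGroundCorr 0 L n x y) := by
    rw [map_sum, Complex.re_sum]
    refine sum_congr rfl fun x _ => ?_
    rw [map_sum, Complex.re_sum]
    refine sum_congr rfl fun y _ => ?_
    rw [map_smul, smul_eq_mul, Complex.re_ofReal_mul, map_sum, Complex.re_sum, Fin.sum_univ_three,
      ← heisGroundCorr_of_neZero, ← heisGroundCorr_of_neZero, ← heisGroundCorr_of_neZero,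
      heisGroundCorr_one_eq_zero, heisGroundCorr_two_eq_zero]
    ring
  rw [hL', hR, Finset.mul_sum]
  refine sum_congr rfl fun x _ => ?_
  rw [Finset.mul_sum]
  refine sum_congr rfl fun y _ => ?_
  ring

/-- **Horsch–von der Linden bound with the sharp constant (spectral form).** For the spin-`n/2`
Heisenberg antiferromagnet on the even torus `(ℤ/Lℤ)^d` (`d ≥ 1`, `J = 1`): if every eigenvalue
is `E₀` or `≥ E₀ + Δ`, then `Δ · Re ω₀(𝓢_π) ≤ -4 E₀`, `𝓢_π = Σ_{x,y} (-1)^x (-1)^y 𝐒_x·𝐒_y`.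
Horsch–von der Linden (1988); Koma–Tasaki (1993) §7 (7.9), (1994) Thm. 2.2; Tasaki (2019) §2 — there
with generic constants; here the model constant is exact. [cite: HorschVonDerLinden1988]
[cite: KomaTasaki1994, Theorem 2.2 (2.9)–(2.10)] [cite: Tasaki2019Tower, §2] -/
theorem gap_mul_re_stagStructure_le_of_eigenvalues (hd : 1 ≤ d) (hL : 2 ∣ L) {Δ : ℝ}
    (hgap : ∀ j, (heisenbergTorus_isHermitian d L n 1).eigenvalues j =
        (heisenbergTorus d L n 1).groundEnergy ∨
      (heisenbergTorus d L n 1).groundEnergy + Δ ≤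
        (heisenbergTorus_isHermitian d L n 1).eigenvalues j) :
    Δ * ((heisenbergTorus d L n 1).groundStateFunctional
        (∑ x : TorusSite d L, ∑ y : TorusSite d L, ((neelSign x * neelSign y : ℝ) : ℂ) •
          ∑ α : Fin 3, (siteSpin n x α * siteSpin n y α : Op (TorusSite d L) (n + 1)))).re ≤
      -4 * (heisenbergTorus d L n 1).groundEnergy := by
  have hH := heisenbergTorus_isHermitian d L n 1
  have hA₀ : (∑ u : TorusSite d L, ((neelSign u : ℝ) : ℂ) •
      (siteSpin n u 0 : Op (TorusSite d L) (n + 1))).IsHermitian := by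
    have h : (∑ u : TorusSite d L, ((neelSign u : ℝ) : ℂ) •
        (siteSpin n u 0 : Op (TorusSite d L) (n + 1))) = ∑ u, stagSiteSpinX L n u := rfl
    rw [h]
    exact (isSelfAdjoint_sum _ fun u _ => (stagSiteSpinX_isHermitian L n u).isSelfAdjoint).isHermitian
  have hV := hH.gap_mul_re_groundStateFunctional_le hgap
    (groundProj_mul_neelWave_mul_groundProj L n hd hL)
  rw [hA₀.eq, Matrix.re_groundStateFunctional_conj_eq_lie_lie hH,
    re_groundStateFunctional_lie_lie_neelWave L n hL] at hV
  rw [re_groundStateFunctional_stagStructure_eq L n]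
  linarith

/-- **Horsch–von der Linden bound with the sharp constant.** For the spin-`n/2` Heisenberg
antiferromagnet on the even torus `(ℤ/Lℤ)^d` (`d ≥ 1`, `J = 1`) with spectral gap `Δ` (unique
ground state and `E₁ - E₀ ≥ Δ > 0`): `Δ · Re ω₀(𝓢_π) ≤ -4 E₀`, i.e.
`E₁ - E₀ ≤ 4 |E₀| / ω₀(𝓢_π)`. Long-range Néel order `ω₀(𝓢_π) ≍ L^{2d}` thus forces a gap
`O(L^{-d})` ("low-lying states"). [cite: HorschVonDerLinden1988]
[cite: KomaTasaki1994, Theorem 2.2 (2.9)–(2.10)] [cite: Tasaki2019Tower, §2] -/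
theorem gap_mul_re_stagStructure_le (hd : 1 ≤ d) (hL : 2 ∣ L) {Δ : ℝ}
    (hΔ : (heisenbergTorus d L n 1).HasSpectralGap Δ) :
    Δ * ((heisenbergTorus d L n 1).groundStateFunctional
        (∑ x : TorusSite d L, ∑ y : TorusSite d L, ((neelSign x * neelSign y : ℝ) : ℂ) •
          ∑ α : Fin 3, (siteSpin n x α * siteSpin n y α : Op (TorusSite d L) (n + 1)))).re ≤
      -4 * (heisenbergTorus d L n 1).groundEnergy :=
  gap_mul_re_stagStructure_le_of_eigenvalues L n hd hL
    fun j => hΔ.eigenvalues_eq_or_le (heisenbergTorus_isHermitian d L n 1) j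

/-- **Energy-free form for spin ½** (`L ≥ 3` even, `d ≥ 1`): with Anderson's bound
`E₀ ≥ -(d+1) L^d / 4`, a spectral gap `Δ` forces `Δ · Re ω₀(𝓢_π) ≤ (d + 1) L^d`, i.e.
`(E₁ - E₀) · m_s(L)² ≤ (d + 1) / L^d` for `m_s² = ω₀(𝓢_π) / L^{2d}` (on the square lattice
`(E₁ - E₀) m_s² ≤ 3 / L²`). [cite: HorschVonDerLinden1988] [cite: Anderson1951]
[cite: Tasaki2019Tower, §2] -/
theorem gap_mul_re_stagStructure_le_spinHalf (hd : 1 ≤ d) (hL : 2 ∣ L) (hL3 : 3 ≤ L) {Δ : ℝ}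
    (hΔ : (heisenbergTorus d L 1 1).HasSpectralGap Δ) :
    Δ * ((heisenbergTorus d L 1 1).groundStateFunctional
        (∑ x : TorusSite d L, ∑ y : TorusSite d L, ((neelSign x * neelSign y : ℝ) : ℂ) •
          ∑ α : Fin 3, (siteSpin 1 x α * siteSpin 1 y α : Op (TorusSite d L) 2))).re ≤
      ((d : ℝ) + 1) * (L : ℝ) ^ d := by
  have h := gap_mul_re_stagStructure_le L 1 hd hL hΔ
  have hE : -((((d : ℝ) + 1) / 4) * (L : ℝ) ^ d) ≤ (heisenbergTorus d L 1 1).groundEnergy :=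
    heisenbergAF_torus_groundEnergy_ge (d := d) L hL3
  linarith

/-- `Re ω₀(𝓢_π) ≥ 0` (`𝓢_π`'s expectation is `3 ω₀(A₀⋆ A₀)`). [cite: KLS1988JSP, p. 1021] [folklore] -/
theorem re_groundStateFunctional_stagStructure_nonneg :
    0 ≤ ((heisenbergTorus d L n 1).groundStateFunctional
        (∑ x : TorusSite d L, ∑ y : TorusSite d L, ((neelSign x * neelSign y : ℝ) : ℂ) •
          ∑ α : Fin 3, (siteSpin n x α * siteSpin n y α : Op (TorusSite d L) (n + 1)))).re := by
  rw [re_groundStateFunctional_stagStructure_eq L n]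
  have hA₀ : (∑ u : TorusSite d L, ((neelSign u : ℝ) : ℂ) •
      (siteSpin n u 0 : Op (TorusSite d L) (n + 1))).IsHermitian := by
    have h : (∑ u : TorusSite d L, ((neelSign u : ℝ) : ℂ) •
        (siteSpin n u 0 : Op (TorusSite d L) (n + 1))) = ∑ u, stagSiteSpinX L n u := rfl
    rw [h]
    exact (isSelfAdjoint_sum _ fun u _ => (stagSiteSpinX_isHermitian L n u).isSelfAdjoint).isHermitian
  have h0 := groundStateFunctional_nonneg_of_posSemidef (heisenbergTorus d L n 1)
    (posSemidef_conjTranspose_mul_self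
      (∑ u : TorusSite d L, ((neelSign u : ℝ) : ℂ) • (siteSpin n u 0 : Op (TorusSite d L) (n + 1))))
  rw [hA₀.eq] at h0
  obtain ⟨hre, -⟩ := Complex.nonneg_iff.1 h0
  linarith

/-- The Néel sum of the two-point function is `Re ω₀(𝓢_π)` (unfolding). [folklore] -/
private theorem neelSum_groundStateSpinCorrTorus_eq :
    ∑ x : TorusSite d L, ∑ y : TorusSite d L,
        (-1 : ℝ) ^ (∑ i, (x i).val) * (-1) ^ (∑ i, (y i).val) * groundStateSpinCorrTorus L n 1 x y =
      ((heisenbergTorus d L n 1).groundStateFunctional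
        (∑ x : TorusSite d L, ∑ y : TorusSite d L, ((neelSign x * neelSign y : ℝ) : ℂ) •
          ∑ α : Fin 3, (siteSpin n x α * siteSpin n y α : Op (TorusSite d L) (n + 1)))).re := by
  rw [map_sum, Complex.re_sum]
  refine sum_congr rfl fun x _ => ?_
  rw [map_sum, Complex.re_sum]
  refine sum_congr rfl fun y _ => ?_
  rw [map_smul, smul_eq_mul, Complex.re_ofReal_mul, groundStateSpinCorrTorus_of_neZero, map_sum]
  rfl

/-- **Uniformly gapped even tori carry no Néel long-range order** (spin ½, `d ≥ 1`, `J = 1`): if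
`H_L` has a spectral gap `≥ Δ > 0` above a unique ground state for all large even `L`, then the
ground states have no staggered long-range order, since `m_s(L)² ≤ (d+1) / (Δ L^d) → 0`.
Contrapositive: Néel order forces low-lying excited states, `E₁ - E₀ = O(L^{-d})` (Horsch–von der
Linden 1988; Koma–Tasaki 1994 Thm. 2.2; Tasaki 2019 §2 "a ground state with LRO but without SSB is
inevitably accompanied by low-lying states"). [cite: HorschVonDerLinden1988]
[cite: KomaTasaki1994, Theorem 2.2 (2.9)–(2.10)] [cite: Tasaki2019Tower, §2] -/
theorem not_hasStaggeredEvenTorusLRO_of_uniform_gap (hd : 1 ≤ d) {Δ : ℝ} (hΔ : 0 < Δ)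
    (hgap : ∀ᶠ k : ℕ in atTop, (heisenbergTorus d (2 * k + 2) 1 1).HasSpectralGap Δ) :
    ¬ HasStaggeredEvenTorusLRO (fun L x y => groundStateSpinCorrTorus (d := d) L 1 1 x y) := by
  rw [hasStaggeredEvenTorusLRO_iff_holds]
  intro hpos
  -- the Néel order parameter of side `2k + 2` is eventually `≤ (d+1) / (Δ (2k+2)^d)`
  have hbound : ∀ᶠ k : ℕ in atTop,
      (∑ x : TorusSite d (2 * k + 2), ∑ y : TorusSite d (2 * k + 2),
          (-1 : ℝ) ^ (∑ i, (x i).val) * (-1) ^ (∑ i, (y i).val) *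
            groundStateSpinCorrTorus (2 * k + 2) 1 1 x y) / ((2 * k + 2 : ℕ) : ℝ) ^ (2 * d) ≤
        ((d : ℝ) + 1) / (Δ * ((2 * k + 2 : ℕ) : ℝ) ^ d) := by
    filter_upwards [hgap, eventually_ge_atTop 1] with k hk hk1
    haveI : NeZero (2 * k + 2) := ⟨by omega⟩
    have h := gap_mul_re_stagStructure_le_spinHalf (2 * k + 2) hd ⟨k + 1, by ring⟩ (by omega) hk
    rw [neelSum_groundStateSpinCorrTorus_eq]
    have hLpos : (0 : ℝ) < ((2 * k + 2 : ℕ) : ℝ) := by positivity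
    rw [div_le_div_iff₀ (by positivity) (by positivity)]
    calc ((heisenbergTorus d (2 * k + 2) 1 1).groundStateFunctional
          (∑ x : TorusSite d (2 * k + 2), ∑ y : TorusSite d (2 * k + 2),
            ((neelSign x * neelSign y : ℝ) : ℂ) •
              ∑ α : Fin 3, (siteSpin 1 x α * siteSpin 1 y α : Op (TorusSite d (2 * k + 2)) 2))).re *
          (Δ * ((2 * k + 2 : ℕ) : ℝ) ^ d)
        = Δ * ((heisenbergTorus d (2 * k + 2) 1 1).groundStateFunctional
          (∑ x : TorusSite d (2 * k + 2), ∑ y : TorusSite d (2 * k + 2),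
            ((neelSign x * neelSign y : ℝ) : ℂ) •
              ∑ α : Fin 3, (siteSpin 1 x α * siteSpin 1 y α : Op (TorusSite d (2 * k + 2)) 2))).re *
          ((2 * k + 2 : ℕ) : ℝ) ^ d := by ring
      _ ≤ ((d : ℝ) + 1) * ((2 * k + 2 : ℕ) : ℝ) ^ d * ((2 * k + 2 : ℕ) : ℝ) ^ d :=
          mul_le_mul_of_nonneg_right h (by positivity)
      _ = ((d : ℝ) + 1) * ((2 * k + 2 : ℕ) : ℝ) ^ (2 * d) := by ring
  -- the bound tends to `0`
  have htend : Tendsto (fun k : ℕ => ((d : ℝ) + 1) / (Δ * ((2 * k + 2 : ℕ) : ℝ) ^ d))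
      atTop (𝓝 0) := by
    have h1 : Tendsto (fun k : ℕ => ((2 * k + 2 : ℕ) : ℝ)) atTop atTop :=
      tendsto_natCast_atTop_atTop.comp (tendsto_atTop_atTop.2 fun b => ⟨b, fun k hk => by omega⟩)
    have h2 : Tendsto (fun k : ℕ => ((2 * k + 2 : ℕ) : ℝ) ^ d) atTop atTop :=
      (tendsto_pow_atTop (by omega : d ≠ 0)).comp h1
    exact tendsto_const_nhds.div_atTop (h2.const_mul_atTop hΔ)
  -- the order parameters are nonnegative, hence bounded below, and eventually above `c / 2`
  have hnonneg : ∀ k : ℕ, 0 ≤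
      (∑ x : TorusSite d (2 * k + 2), ∑ y : TorusSite d (2 * k + 2),
          (-1 : ℝ) ^ (∑ i, (x i).val) * (-1) ^ (∑ i, (y i).val) *
            groundStateSpinCorrTorus (2 * k + 2) 1 1 x y) / ((2 * k + 2 : ℕ) : ℝ) ^ (2 * d) := by
    intro k
    haveI : NeZero (2 * k + 2) := ⟨by omega⟩
    rw [neelSum_groundStateSpinCorrTorus_eq]
    exact div_nonneg (re_groundStateFunctional_stagStructure_nonneg (2 * k + 2) 1) (by positivity)
  have hev := eventually_lt_of_lt_liminf (half_lt_self hpos) (isBoundedUnder_of ⟨0, hnonneg⟩)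
  have hlt := htend.eventually (eventually_lt_nhds (half_pos hpos))
  obtain ⟨k, hk1, hk2, hk3⟩ := (hev.and (hbound.and hlt)).exists
  linarith

end NeelWave

end Literature.MathematicalPhysics.QuantumLattice

end
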